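import Summits.BirchSwinnertonDyer.BirchSwinnertonDyer.Theorems.BiquadraticEisensteinDescentEisensteinHeartFlatCMInertBadKPrimeBranchBadPrimes
import Literature.NumberTheory.EllipticCurves.KatzPAdicLFunctionCMField
import Literature.NumberTheory.EllipticCurves.RankinSelbergEulerProductHeckeInducedProofs
import Literature.NumberTheory.DiophantineGeometry.LocalReductionFiniteBadPlacesProofs
import Mathlib.SetTheory.Cardinal.Order
import HarnessLib

set_option linter.dupNamespace false -- `Summit.BirchSwinnertonDyer.BirchSwinnertonDyer.Theorems.…` (summit = sub)
set_option autoImplicit false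

/-!
# Crux `EisensteinHeartFlatCMInertBadKPrime` (stmt-BirchSwinnertonDyer-21341), line `hsieh-lambda`, layer 2 (V2) —
# BOOKKEEPING of the Katz frame: the sets `S ⊇ T`, `D`, and the ramification of `λ = (ψ ∘ N_{L/K_CM}) · ‖·‖_L`

Route `BiquadraticEisensteinDescent` (cell `pub/bsd-wall`, width seat `bsd-wall-cm-bed-w1`; lead `bsd-wall-cm-bed-p1`).
THEOREMS ONLY (no definition, no named fact, no `sorry`); supports stmt-BirchSwinnertonDyer-21341 as a helper; nothing about the
crux's input (stub `V4`) or any case of BSD is asserted.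

## What is discharged

The V2 stub closer `…KatzHsiehSocket.exists_isBaseChangeLine_span_C_mul_eq` (p609851) carries, besides the named Katz existence
fact and (T)(C)(L)(P), the MODULUS BOOKKEEPING of `KatzCM.exists_isBaseChangeLine'` — finite sets `S ⊇ T` and `D` of places of
`L` with `hS : ∀ w ∈ S, p ∉ w`, `hTS`, `hTc : ∀ w ∈ T, c w ≠ w ∧ c w ∉ T`, `hST : ∀ w ∈ S, c w ≠ w → w ∈ T ∨ c w ∈ T`,
`hD₁ : {w ∣ p} ⊆ D`, `hD₂ : S ⊆ D`, `hD₃ : c S ⊆ D`, `hD₄`, `hd2` — and the ramification profile of the branch character: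
`hlam` (`λ` unramified off `S ∪ {w ∣ p}`), `hramS` (`λ` ramified on `S ∪ {w ∣ p}`), `hramT` (on `Σ_p ∪ T`). For
`λ := ψ.compRelNorm L * HeckeCharacter.normCharacter L` (`ψ` on the CM field `K₁ ⊆ L` with Deuring's clause (iii)) this file
gives the CHOICE and all these binders except `hD₄` (`L/L⁺` unramified at finite primes — `…Genus`, width seat w2) and `hd2`
(Hsieh's `ϑ`, `…Theta.exists_theta`), namely with

  `S` := the places above the bad rational places other than `(p)`  (`w ∈ S ↔ ¬ W good at w ∩ ℚ ∧ p ∉ w`; `exists_finset_S`),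
  `T` := a half of the conjugate pairs of `S` (`exists_finset_T`),   `D := KatzCM.primesOver L p ∪ S` (`hD_of_union`):

* §1 places: `under_under`, `minFac_absNorm_mem` (a rational prime in every `w`), `under_rat_eq_of_natCast_mem`,
  `natCast_mem_smul_iff`;
* §2 `hasGoodReductionAt_baseChange_cmField` (`E_{K₁}` GOOD above good `ℓ` — companion of `…BranchBadPrimes`),
  **`isUnramifiedAt_lam_of_good`**, **`not_isUnramifiedAt_lam_of_bad`** (modulo `hunr`, = `…BranchUnramified.hunr_of_frame` at
  `K₁ = ℚ⟮x⟯`);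
* §3 `exists_finset_S`, `hS_of_mem`, `smul_mem_S` (`S` is stable under every automorphism, in particular `c`), **`hlam_of_mem`**,
  **`hramS_of_mem`**, **`hramT_of_mem`** (for any `Σ_p ⊆ {w ∣ p}`, `T ⊆ S`);
* §4 `exists_finset_T` (any involution `c` preserving `S`; `hTS ∧ hTc ∧ hST`), `complexConj_mul_complexConj`, `hD_of_union`
  (`hD₁ ∧ hD₂ ∧ hD₃`), `exists_prime_mem_of_mem_D` (every `w ∈ D` lies above `p` or a bad `ℓ` — the shape in which
  `exists_theta` with `P :=` prime divisors of `p N_W` delivers `hd2` on `D`).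

References: [Hsieh2014mu] §3.1, §4.1 (the modulus `ℭ`, `𝔉`, (d2)); [SilvermanATAEC1994] Ch. II Thm. 9.2 (b); [SilvermanAEC2009]
VIII.1 Rem. 1.3, VII.5.4 (a); [CasselsFrohlichANT1967] Ch. VII §1.1; [NeukirchANT1999] Ch. I §8.
-/

noncomputable section

open scoped Classical NumberField Pointwise
open NumberField IsDedekindDomain Module

namespace Summit.BirchSwinnertonDyer.BirchSwinnertonDyer.Theorems.BiquadraticEisensteinDescentEisensteinHeartFlatCMInertBadKPrimeKatzFrameBookkeeping

open Literature.NumberTheory.EllipticCurves Literature.NumberTheory.GaloisRepresentations Literature.NumberTheory.Automorphic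
open Summit.BirchSwinnertonDyer.BirchSwinnertonDyer.Theorems.BiquadraticEisensteinDescentEisensteinHeartFlatCMInertBadKPrimeBranchBadPrimes

variable {K₁ L : Type} [Field K₁] [NumberField K₁] [Field L] [NumberField L] [Algebra K₁ L]

/-! ### §1 Places: the rational prime below a place; conjugate places lie over the same rational place -/

omit [NumberField K₁] [Algebra K₁ L] in
/-- Transitivity of restriction of places: `(w ∩ 𝓞 K₁) ∩ 𝓞 ℚ = w ∩ 𝓞 ℚ`. [cite: NeukirchANT1999, Ch. I §8] -/
theorem under_under [NumberField K₁] [Algebra K₁ L] (w : HeightOneSpectrum (𝓞 L)) :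
    (w.under (𝓞 K₁)).under (𝓞 ℚ) = w.under (𝓞 ℚ) := by
  ext1
  simp [HeightOneSpectrum.under_asIdeal, Ideal.under_under]

omit [Algebra K₁ L] [NumberField K₁] in
/-- Every finite place `w` of `L` contains a rational prime: `ℓ = N(w).minFac ∈ w`. [cite: NeukirchANT1999, Ch. I §8 (8.2)–(8.3)] -/
theorem minFac_absNorm_mem (w : HeightOneSpectrum (𝓞 L)) :
    (Ideal.absNorm w.asIdeal).minFac.Prime ∧ ((Ideal.absNorm w.asIdeal).minFac : 𝓞 L) ∈ w.asIdeal := by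
  obtain ⟨k, -, -, hℓ, hN, -⟩ := absNorm_heightOneSpectrum_eq_pow w
  refine ⟨hℓ, ?_⟩
  have h1 : ((Ideal.absNorm w.asIdeal : ℕ) : 𝓞 L) ∈ w.asIdeal := Ideal.absNorm_mem w.asIdeal
  rw [hN, Nat.cast_pow] at h1
  exact Ideal.IsPrime.mem_of_pow_mem w.isPrime _ h1

omit [Algebra K₁ L] [NumberField K₁] in
/-- Two places of `L` containing the same rational prime `ℓ` restrict to the same place `(ℓ)` of `ℚ`. [folklore] -/
theorem under_rat_eq_of_natCast_mem {ℓ : ℕ} (hℓ : ℓ.Prime) {w w' : HeightOneSpectrum (𝓞 L)}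
    (hw : (ℓ : 𝓞 L) ∈ w.asIdeal) (hw' : (ℓ : 𝓞 L) ∈ w'.asIdeal) : w.under (𝓞 ℚ) = w'.under (𝓞 ℚ) := by
  apply (Rat.HeightOneSpectrum.primesEquiv (R := 𝓞 ℚ)).injective
  apply Subtype.ext
  change Rat.HeightOneSpectrum.natGenerator (w.under (𝓞 ℚ)) = Rat.HeightOneSpectrum.natGenerator (w'.under (𝓞 ℚ))
  rw [natGenerator_under_eq L w hℓ hw, natGenerator_under_eq L w' hℓ hw']

omit [Algebra K₁ L] [NumberField K₁] [NumberField L] in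
/-- A Galois conjugate of a place contains the same rational integers. [cite: CasselsFrohlichANT1967, Ch. VII §1.1] -/
theorem natCast_mem_smul_iff {F : Type} [Field F] [NumberField F] [Algebra F L] (g : L ≃ₐ[F] L)
    (w : HeightOneSpectrum (𝓞 L)) (n : ℕ) : ((n : ℕ) : 𝓞 L) ∈ (g • w).asIdeal ↔ ((n : ℕ) : 𝓞 L) ∈ w.asIdeal := by
  have hn : g • ((n : ℕ) : 𝓞 L) = n := by
    apply Subtype.ext
    change g (((n : ℕ) : 𝓞 L) : L) = ((n : ℕ) : 𝓞 L)
    simp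
  rw [← HeightOneSpectrum.smul_mem_smul_asIdeal_iff g w, hn]

/-! ### §2 The ramification of `λ = (ψ ∘ N_{L/K₁}) · ‖·‖_L` (CM field `K₁ ⊆ L`, Deuring (iii) for `ψ`) -/

section Lam

variable [IsGalois K₁ L] (W : WeierstrassCurve ℚ) [W.IsElliptic]

/-- In a quadratic field every place has ramification index `1` or `2` over `ℚ`. [cite: NeukirchANT1999, Ch. I (8.2)] -/
theorem ramificationIdx_eq_one_or_two (h2 : finrank ℚ K₁ = 2) (v : HeightOneSpectrum (𝓞 K₁)) :
    v.asIdeal.ramificationIdx (𝓞 ℚ) = 1 ∨ v.asIdeal.ramificationIdx (𝓞 ℚ) = 2 := by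
  rcases placesOver_trichotomy_of_finrank_eq_two K₁ h2 (v.under (𝓞 ℚ)) with
    ⟨w₁, w₂, -, -, hall⟩ | ⟨w₀, hS, he1, -⟩ | ⟨w₀, hS, he2, -⟩
  · exact Or.inl (hall v rfl).1
  · have hw : v ∈ ({w' : HeightOneSpectrum (𝓞 K₁) | w'.under (𝓞 ℚ) = v.under (𝓞 ℚ)}) := rfl
    rw [hS, Set.mem_singleton_iff] at hw
    subst hw
    exact Or.inl he1
  · have hw : v ∈ ({w' : HeightOneSpectrum (𝓞 K₁) | w'.under (𝓞 ℚ) = v.under (𝓞 ℚ)}) := rfl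
    rw [hS, Set.mem_singleton_iff] at hw
    subst hw
    exact Or.inr he2

/-- **`E_K` is GOOD at every prime of the CM field above a good rational place** (converse companion of
`…BranchBadPrimes.not_hasGoodReductionAt_baseChange_cmField`): at `e = 1` by unramified base change, while `e = 2` cannot occur
above a good prime (`Deuring_localEulerFactor_ramified`: `L_ℓ(E) = 1`, contradicting good reduction at `ℓ`).
[cite: SilvermanATAEC1994, Ch. II Ex. 2.31(a), 2.32(a) and Thm. 9.2 (b)] [cite: SilvermanAEC2009, Prop. VII.5.4 (a)] -/
theorem hasGoodReductionAt_baseChange_cmField (hj : W.j ∈ maximalCMJInvariants) (hK₁ : IsCMFieldOfJ K₁ W.j)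
    (v : HeightOneSpectrum (𝓞 K₁)) (hgood : W.HasGoodReductionAt (v.under (𝓞 ℚ))) :
    (W.baseChange K₁).HasGoodReductionAt v := by
  rcases ramificationIdx_eq_one_or_two hK₁.1 v with he | he
  · exact (hasGoodReductionAt_baseChange_iff_of_ramificationIdx_eq_one W K₁ v he).mpr hgood
  · exact absurd (Deuring_localEulerFactor_ramified W hj K₁ hK₁ v he).2
      (localEulerFactor_ne_one_of_hasGoodReductionAt W (v.under (𝓞 ℚ)) hgood)

variable {W}
variable (hj : W.j ∈ maximalCMJInvariants) (hK₁ : IsCMFieldOfJ K₁ W.j) {ψ : HeckeCharacter K₁}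
  (hψ : ∀ v : HeightOneSpectrum (𝓞 K₁), ψ.IsUnramifiedAt v ↔ (W.baseChange K₁).HasGoodReductionAt v)

include hj hK₁ hψ

/-- **`λ = (ψ ∘ N_{L/K₁}) · ‖·‖_L` is UNRAMIFIED at every place of `L` above a good rational place** (Deuring (iii): `ψ` is
unramified at `v = w ∩ K₁` since `E_{K₁}` is good there; `ψ ∘ N` inherits it, `HeckeCharacter.compRelNorm_isUnramifiedAt`; the
norm character is unramified everywhere). [cite: SilvermanATAEC1994, Ch. II Thm. 9.2 (b)] -/
theorem isUnramifiedAt_lam_of_good (w : HeightOneSpectrum (𝓞 L)) (hgood : W.HasGoodReductionAt (w.under (𝓞 ℚ))) :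
    (ψ.compRelNorm L * HeckeCharacter.normCharacter L).IsUnramifiedAt w := by
  have hv : (W.baseChange K₁).HasGoodReductionAt (w.under (𝓞 K₁)) :=
    hasGoodReductionAt_baseChange_cmField W hj hK₁ _ (by rw [under_under]; exact hgood)
  exact (ψ.compRelNorm_isUnramifiedAt ((hψ _).mpr hv)).mul' (HeckeCharacter.isUnramifiedAt_normCharacter' w)

/-- **`λ` is RAMIFIED at every place of `L` above a bad rational place**, granted `L/K₁` unramified above the bad primes
(binder `hunr`, discharged at the frame by `…BranchUnramified.hunr_of_frame`): `…BranchBadPrimes.not_isUnramifiedAt_compRelNorm_of_bad`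
and the norm character is unramified. [cite: SilvermanATAEC1994, Ch. II Thm. 9.2 (b)] [cite: Childress2009, Ch. 4 §5 Lemma 5.3 (a)] -/
theorem not_isUnramifiedAt_lam_of_bad
    (hunr : ∀ (ℓ : ℕ) [Fact ℓ.Prime], ¬ W.HasGoodReductionAtPrime ℓ →
      ∀ v : HeightOneSpectrum (𝓞 K₁), (ℓ : 𝓞 K₁) ∈ v.asIdeal → Algebra.IsUnramifiedIn (𝓞 L) v.asIdeal)
    (w : HeightOneSpectrum (𝓞 L)) (hbad : ¬ W.HasGoodReductionAt (w.under (𝓞 ℚ))) :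
    ¬ (ψ.compRelNorm L * HeckeCharacter.normCharacter L).IsUnramifiedAt w := by
  obtain ⟨hℓ, hℓw⟩ := minFac_absNorm_mem w
  haveI : Fact (Ideal.absNorm w.asIdeal).minFac.Prime := ⟨hℓ⟩
  have hbad' : ¬ W.HasGoodReductionAtPrime (Ideal.absNorm w.asIdeal).minFac := by
    rwa [← hasGoodReductionAt_under_iff W L w hℓw]
  have h := not_isUnramifiedAt_compRelNorm_of_bad W hj hK₁ hψ hunr _ hbad' w hℓw
  exact fun hmul ↦ h ((KatzCM.isUnramifiedAt_mul_iff_of_range (HeckeCharacter.isUnramifiedAt_normCharacter' w)).mp hmul)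

end Lam

/-! ### §3 The set `S` (primes above bad `ℓ ≠ p`): existence, `hS`, `hlam`, `hramS`, stability under conjugation -/

section SetS

variable (W : WeierstrassCurve ℚ) [W.IsElliptic] (p : ℕ)

omit [NumberField K₁] [Algebra K₁ L] in
/-- **The bookkeeping set `S` exists as a `Finset`**: the places of `L` above the bad rational places other than `(p)` are finitely
many (finitely many bad places of `E/ℚ`, `finite_badPlaces_holds`; finite fibres). [cite: SilvermanAEC2009, VIII.1 Remark 1.3] -/
theorem exists_finset_S :
    ∃ S : Finset (HeightOneSpectrum (𝓞 L)), ∀ w, w ∈ S ↔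
      ¬ W.HasGoodReductionAt (w.under (𝓞 ℚ)) ∧ ((p : ℕ) : 𝓞 L) ∉ w.asIdeal := by
  have hfin : ({w : HeightOneSpectrum (𝓞 L) |
      ¬ W.HasGoodReductionAt (w.under (𝓞 ℚ)) ∧ ((p : ℕ) : 𝓞 L) ∉ w.asIdeal}).Finite := by
    have hbad : (W.badPlaces (𝓞 ℚ)).Finite := WeierstrassCurve.finite_badPlaces_holds (𝓞 ℚ) W
    refine Set.Finite.subset (Set.Finite.biUnion hbad fun v _ ↦ setOf_under_eq_finite (K := ℚ) (L := L) v) ?_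
    intro w hw
    simp only [Set.mem_iUnion, Set.mem_setOf_eq]
    exact ⟨w.under (𝓞 ℚ), hw.1, rfl⟩
  exact ⟨hfin.toFinset, fun w ↦ by rw [Set.Finite.mem_toFinset, Set.mem_setOf_eq]⟩

variable {S : Finset (HeightOneSpectrum (𝓞 L))}
  (hSmem : ∀ w, w ∈ S ↔ ¬ W.HasGoodReductionAt (w.under (𝓞 ℚ)) ∧ ((p : ℕ) : 𝓞 L) ∉ w.asIdeal)

include hSmem

omit [NumberField K₁] [Algebra K₁ L] [W.IsElliptic] in
/-- `hS`: the primes of `S` are prime to `p`. [folklore] -/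
theorem hS_of_mem : ∀ w ∈ S, ((p : ℕ) : 𝓞 L) ∉ w.asIdeal := fun w hw ↦ ((hSmem w).mp hw).2

omit [NumberField K₁] [Algebra K₁ L] [W.IsElliptic] in
/-- `S` is stable under any `F`-automorphism of `L` (e.g. complex conjugation over `L⁺`): conjugate places lie over the same
rational place and contain the same rational integers. [cite: CasselsFrohlichANT1967, Ch. VII §1.1] -/
theorem smul_mem_S {F : Type} [Field F] [NumberField F] [Algebra F L] (g : L ≃ₐ[F] L) {w : HeightOneSpectrum (𝓞 L)}
    (hw : w ∈ S) : g • w ∈ S := by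
  obtain ⟨hbad, hp⟩ := (hSmem w).mp hw
  obtain ⟨hℓ, hℓw⟩ := minFac_absNorm_mem w
  refine (hSmem _).mpr ⟨?_, fun h ↦ hp ((natCast_mem_smul_iff g w p).mp h)⟩
  rwa [under_rat_eq_of_natCast_mem hℓ ((natCast_mem_smul_iff g w _).mpr hℓw) hℓw]

variable [IsGalois K₁ L] {W}
variable (hj : W.j ∈ maximalCMJInvariants) (hK₁ : IsCMFieldOfJ K₁ W.j) {ψ : HeckeCharacter K₁}
  (hψ : ∀ v : HeightOneSpectrum (𝓞 K₁), ψ.IsUnramifiedAt v ↔ (W.baseChange K₁).HasGoodReductionAt v)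

include hj hK₁ hψ

/-- **`hlam`: `λ` is unramified outside `S ∪ {w ∣ p}`.** [cite: SilvermanATAEC1994, Ch. II Thm. 9.2 (b)] -/
theorem hlam_of_mem : ∀ w : HeightOneSpectrum (𝓞 L), w ∉ S → ((p : ℕ) : 𝓞 L) ∉ w.asIdeal →
    (ψ.compRelNorm L * HeckeCharacter.normCharacter L).IsUnramifiedAt w := by
  intro w hwS hwp
  by_cases hgood : W.HasGoodReductionAt (w.under (𝓞 ℚ))
  · exact isUnramifiedAt_lam_of_good hj hK₁ hψ w hgood
  · exact absurd ((hSmem w).mpr ⟨hgood, hwp⟩) hwS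

/-- **`hramS`: `λ` is ramified on `S ∪ {w ∣ p}`** (`p` itself a bad prime of `W`), granted `L/K₁` unramified above bad primes.
[cite: SilvermanATAEC1994, Ch. II Thm. 9.2 (b)] [cite: Childress2009, Ch. 4 §5 Lemma 5.3 (a)] -/
theorem hramS_of_mem [Fact p.Prime] (hpbad : ¬ W.HasGoodReductionAtPrime p)
    (hunr : ∀ (ℓ : ℕ) [Fact ℓ.Prime], ¬ W.HasGoodReductionAtPrime ℓ →
      ∀ v : HeightOneSpectrum (𝓞 K₁), (ℓ : 𝓞 K₁) ∈ v.asIdeal → Algebra.IsUnramifiedIn (𝓞 L) v.asIdeal) :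
    ∀ w ∈ S ∪ KatzCM.primesOver L p, ¬ (ψ.compRelNorm L * HeckeCharacter.normCharacter L).IsUnramifiedAt w := by
  intro w hw
  rcases Finset.mem_union.mp hw with hw | hw
  · exact not_isUnramifiedAt_lam_of_bad hj hK₁ hψ hunr w ((hSmem w).mp hw).1
  · have hpw : ((p : ℕ) : 𝓞 L) ∈ w.asIdeal := KatzCM.mem_primesOver.mp hw
    refine not_isUnramifiedAt_lam_of_bad hj hK₁ hψ hunr w ?_
    rwa [hasGoodReductionAt_under_iff W L w hpw]

/-- **`hramT`: `λ` is ramified on `Σ_p ∪ T`** for any `Σ_p` consisting of places above `p` (e.g. a `p`-adic CM type) and any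
`T ⊆ S`. [cite: SilvermanATAEC1994, Ch. II Thm. 9.2 (b)] -/
theorem hramT_of_mem [Fact p.Prime] (hpbad : ¬ W.HasGoodReductionAtPrime p)
    (hunr : ∀ (ℓ : ℕ) [Fact ℓ.Prime], ¬ W.HasGoodReductionAtPrime ℓ →
      ∀ v : HeightOneSpectrum (𝓞 K₁), (ℓ : 𝓞 K₁) ∈ v.asIdeal → Algebra.IsUnramifiedIn (𝓞 L) v.asIdeal)
    {Sp T : Finset (HeightOneSpectrum (𝓞 L))} (hSp : ∀ w ∈ Sp, ((p : ℕ) : 𝓞 L) ∈ w.asIdeal) (hTS : T ⊆ S) :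
    ∀ w ∈ Sp ∪ T, ¬ (ψ.compRelNorm L * HeckeCharacter.normCharacter L).IsUnramifiedAt w := by
  intro w hw
  refine hramS_of_mem p hSmem hj hK₁ hψ hpbad hunr w (Finset.mem_union.mpr ?_)
  rcases Finset.mem_union.mp hw with hw | hw
  · exact Or.inr (KatzCM.mem_primesOver.mpr (hSp w hw))
  · exact Or.inl (hTS hw)

end SetS

/-! ### §4 The set `T`: a half of the conjugate pairs of `S`; the set `D = {w ∣ p} ∪ S` -/

section SetT

variable {F : Type} [Field F] [NumberField F] [Algebra F L] (c : L ≃ₐ[F] L) (hcc : c * c = 1)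
  {S : Finset (HeightOneSpectrum (𝓞 L))} (hSc : ∀ w ∈ S, c • w ∈ S)

include hcc hSc

omit [NumberField K₁] [Algebra K₁ L] [NumberField F] [NumberField L] in
/-- **The set `T` exists**: a subset `T ⊆ S` containing exactly one of `w, c w` for every `w ∈ S` moved by the involution `c`
(a half of each conjugate pair, chosen by a well-ordering of the places) — the binders `hTS`, `hTc`, `hST` of the Katz fact.
[cite: Hsieh2014mu, §4.1 (the prime-to-`p` modulus `ℭ = ℭ⁺ℭ⁻`, `ℭ⁻ = 𝔉𝔉_c`)] -/
theorem exists_finset_T : ∃ T : Finset (HeightOneSpectrum (𝓞 L)), T ⊆ S ∧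
    (∀ w ∈ T, c • w ≠ w ∧ c • w ∉ T) ∧ (∀ w ∈ S, c • w ≠ w → (w ∈ T ∨ c • w ∈ T)) := by
  have hinv : ∀ w : HeightOneSpectrum (𝓞 L), c • c • w = w := fun w ↦ by rw [smul_smul, hcc, one_smul]
  refine ⟨S.filter (fun w ↦ c • w ≠ w ∧ WellOrderingRel w (c • w)), Finset.filter_subset _ _, ?_, ?_⟩
  · intro w hw
    obtain ⟨-, hne, hlt⟩ := Finset.mem_filter.mp hw
    refine ⟨hne, fun h ↦ ?_⟩
    obtain ⟨-, -, hlt'⟩ := Finset.mem_filter.mp h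
    rw [hinv] at hlt'
    exact asymm_of WellOrderingRel hlt hlt'
  · intro w hw hne
    rcases trichotomous_of WellOrderingRel w (c • w) with h | h | h
    · exact Or.inl (Finset.mem_filter.mpr ⟨hw, hne, h⟩)
    · exact absurd h.symm hne
    · refine Or.inr (Finset.mem_filter.mpr ⟨hSc w hw, ?_, ?_⟩)
      · rw [hinv]; exact Ne.symm hne
      · rwa [hinv]

end SetT

/-- For the complex conjugation of a CM field `c ∘ c = 1`. [cite: NeukirchANT1999, Ch. III §1] -/
theorem complexConj_mul_complexConj [IsCMField L] : IsCMField.complexConj L * IsCMField.complexConj L = 1 := by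
  ext z
  simp [AlgEquiv.mul_apply]

omit [NumberField K₁] [Algebra K₁ L] in
/-- **`hD₁`, `hD₂`, `hD₃` for `D := {w ∣ p} ∪ S`** (`S` conjugation-stable). [cite: Hsieh2014mu, §4.1 (the set of primes where (d2) is imposed)] -/
theorem hD_of_union (p : ℕ) [Fact p.Prime] [IsCMField L] {S : Finset (HeightOneSpectrum (𝓞 L))}
    (hSc : ∀ w ∈ S, IsCMField.complexConj L • w ∈ S) :
    KatzCM.primesOver L p ⊆ KatzCM.primesOver L p ∪ S ∧ S ⊆ KatzCM.primesOver L p ∪ S ∧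
      ∀ w ∈ S, IsCMField.complexConj L • w ∈ KatzCM.primesOver L p ∪ S :=
  ⟨Finset.subset_union_left, Finset.subset_union_right, fun w hw ↦ Finset.mem_union_right _ (hSc w hw)⟩

omit [NumberField K₁] [Algebra K₁ L] in
/-- Every member of `D = {w ∣ p} ∪ S` lies above `p` or above a bad prime of `W` — the form in which `…Theta.exists_theta`
(Hsieh's (d2) on all primes above a finite set `P` of rational primes, here `P =` prime divisors of `p N_W`) yields `hd2` on `D`.
[cite: Hsieh2014mu, §3.1 (d2)] -/
theorem exists_prime_mem_of_mem_D (W : WeierstrassCurve ℚ) [W.IsElliptic] (p : ℕ) [Fact p.Prime]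
    {S : Finset (HeightOneSpectrum (𝓞 L))}
    (hSmem : ∀ w, w ∈ S ↔ ¬ W.HasGoodReductionAt (w.under (𝓞 ℚ)) ∧ ((p : ℕ) : 𝓞 L) ∉ w.asIdeal)
    {w : HeightOneSpectrum (𝓞 L)} (hw : w ∈ KatzCM.primesOver L p ∪ S) :
    ∃ ℓ : ℕ, ∃ _ : Fact ℓ.Prime, (ℓ : 𝓞 L) ∈ w.asIdeal ∧ (ℓ = p ∨ ¬ W.HasGoodReductionAtPrime ℓ) := by
  rcases Finset.mem_union.mp hw with hw | hw
  · exact ⟨p, inferInstance, KatzCM.mem_primesOver.mp hw, Or.inl rfl⟩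
  · obtain ⟨hℓ, hℓw⟩ := minFac_absNorm_mem w
    refine ⟨(Ideal.absNorm w.asIdeal).minFac, ⟨hℓ⟩, hℓw, Or.inr ?_⟩
    haveI : Fact (Ideal.absNorm w.asIdeal).minFac.Prime := ⟨hℓ⟩
    rw [← hasGoodReductionAt_under_iff W L w hℓw]
    exact ((hSmem w).mp hw).1

end Summit.BirchSwinnertonDyer.BirchSwinnertonDyer.Theorems.BiquadraticEisensteinDescentEisensteinHeartFlatCMInertBadKPrimeKatzFrameBookkeeping

end
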